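import Literature.Probability.RandomPlanarGeometry.LatticeSlitIncrements
import HarnessLib

/-!
# The quotient hull `g_{K₁}(K₂ ∖ K₁)` in the tree's total coordinates `hydroFun` / `hcapOf`

Topic `Literature/Probability/RandomPlanarGeometry`. For hulls `K₁ ⊆ K₂` of `ℍ` (both with
hydrodynamic maps, bounded parts in `ℍ`), G. F. Lawler, *Conformally Invariant Processes in the
Plane* (2005), §3.4 (3.8): `g_{K₂} = g_{g_{K₁}(K₂ ∖ K₁)} ∘ g_{K₁}` and
`hcap(K₂) = hcap(K₁) + hcap(g_{K₁}(K₂ ∖ K₁))` — in Loewner theory `g_{s,t} = g_t ∘ g_s⁻¹`,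
`hcap(g_s(K_t ∖ K_s)) = 2(t - s)` (Rem. 4.9). `HydrodynamicMaps.lean` proves this for abstract
conformal equivalences (`diffImage`, `diffQuotient`, `IsHydrodynamicMap.hcap_diffQuotient`). This
file repackages it for the TOTAL objects `hydroFun K`, `hcapOf K` of `LatticeSlitIncrements.lean`,
in which the lattice pasts are read:

* `quotHull K₁ K₂ = hydroFun K₁ '' ((ℍ ∖ K₁) ∩ K₂)` — the quotient hull (a subset of `ℍ`; it is the
  tree's `diffImage (hydroEquiv K₁ _) K₂`, `quotHull_eq_diffImage`), with
  `ℍ ∖ quotHull K₁ K₂ = hydroFun K₁ '' (ℍ ∖ K₂)` (`diff_quotHull_eq`);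
* `hasHydroMap_quotHull` — it carries a hydrodynamic map (the quotient map `g_{K₂} ∘ g_{K₁}⁻¹`);
* `hydroFun_quotHull_comp_eqOn` — **`g_{quotHull} ∘ g_{K₁} = g_{K₂}` on `ℍ ∖ K₂`**;
* `hcapOf_quotHull` — **`hcapOf (quotHull K₁ K₂) = hcapOf K₂ - hcapOf K₁`**;
* lattice form (`LatticeSlit.capTime_sub_capTime_eq`): for two walks with nested bounded hulls,
  `2 (t_{η₂} - t_{η₁}) = hcapOf (quotHull K_{η₁} K_{η₂})`.

With these, "a continuous `U` drives the conjugated growth `K_{j} ⊆ K_{j+1} ⊆ ⋯`" only has to be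
checked on the quotient hulls `quotHull K_j K_k` themselves (hulls and maps of the chain of `U`);
the composition with `g_{K_j}` and the capacity clock `t_k - t_j` then come for free.

## References

* G. F. Lawler, *Conformally Invariant Processes in the Plane*, AMS (2005), §3.4 (3.8), Ch. 4
  Rem. 4.9 [Lawler2005].
-/

noncomputable section

open Set Filter Topology Metric Bornology Complex
open UpperHalfPlane (upperHalfPlaneSet isOpen_upperHalfPlaneSet)
open Literature.Probability.LatticeModels (meshPoint discreteDomainGraph Site)

namespace Literature.Probability.RandomPlanarGeometry

variable {K₁ K₂ : Set ℂ}

/-- **The quotient hull `g_{K₁}(K₂ ∖ K₁)`** (its part in `ℍ`), in the total coordinates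
`hydroFun`. [cite: Lawler2005, §3.4 (3.8)] -/
def quotHull (K₁ K₂ : Set ℂ) : Set ℂ := hydroFun K₁ '' ((upperHalfPlaneSet \ K₁) ∩ K₂)

/-- The quotient hull is the tree's `diffImage` of the chosen map. [folklore] -/
theorem quotHull_eq_diffImage (h₁ : HasHydroMap K₁) : quotHull K₁ K₂ = diffImage (hydroEquiv K₁ h₁) K₂ :=
  image_congr fun _ hz ↦ hydroFun_apply h₁ hz.1

/-- The quotient hull lies in `ℍ`. [folklore] -/
theorem quotHull_subset (h₁ : HasHydroMap K₁) : quotHull K₁ K₂ ⊆ upperHalfPlaneSet := by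
  rw [quotHull_eq_diffImage h₁]; exact diffImage_subset

/-- `K₁ ⊆ K₂` gives `ℍ ∖ K₂ ⊆ ℍ ∖ K₁`. [folklore] -/
theorem diff_subset_diff_of_subset (h : K₁ ⊆ K₂) : upperHalfPlaneSet \ K₂ ⊆ upperHalfPlaneSet \ K₁ :=
  sdiff_subset_sdiff_right h

/-- **`ℍ ∖ quotHull K₁ K₂ = g_{K₁}(ℍ ∖ K₂)`.** [folklore] -/
theorem diff_quotHull_eq (h₁ : HasHydroMap K₁) (h12 : upperHalfPlaneSet \ K₂ ⊆ upperHalfPlaneSet \ K₁) :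
    upperHalfPlaneSet \ quotHull K₁ K₂ = hydroFun K₁ '' (upperHalfPlaneSet \ K₂) := by
  rw [quotHull_eq_diffImage h₁, diff_diffImage_eq h12]
  exact (image_congr fun z hz ↦ hydroFun_apply h₁ (h12 hz)).symm

/-- `g_{K₁}` maps `ℍ ∖ K₂` into `ℍ ∖ quotHull K₁ K₂`. [folklore] -/
theorem mapsTo_hydroFun_diff_quotHull (h₁ : HasHydroMap K₁)
    (h12 : upperHalfPlaneSet \ K₂ ⊆ upperHalfPlaneSet \ K₁) :
    MapsTo (hydroFun K₁) (upperHalfPlaneSet \ K₂) (upperHalfPlaneSet \ quotHull K₁ K₂) := by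
  rw [diff_quotHull_eq h₁ h12]
  exact mapsTo_image _ _

/-- The part of the quotient hull in `ℍ` is bounded. [folklore] -/
theorem isBounded_quotHull (h₁ : HasHydroMap K₁) (hb₁ : IsBounded (K₁ ∩ upperHalfPlaneSet))
    (hb₂ : IsBounded (K₂ ∩ upperHalfPlaneSet)) : IsBounded (quotHull K₁ K₂ ∩ upperHalfPlaneSet) := by
  rw [quotHull_eq_diffImage h₁]
  exact (isHydrodynamicMap_hydroEquiv h₁).isBounded_diffImage hb₁ hb₂

/-- **The quotient hull carries a hydrodynamic map** (the quotient `g_{K₂} ∘ g_{K₁}⁻¹`).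
[cite: Lawler2005, §3.4 (3.8)] -/
theorem hasHydroMap_quotHull (h₁ : HasHydroMap K₁) (h₂ : HasHydroMap K₂)
    (hb₁ : IsBounded (K₁ ∩ upperHalfPlaneSet)) (h12 : upperHalfPlaneSet \ K₂ ⊆ upperHalfPlaneSet \ K₁) :
    HasHydroMap (quotHull K₁ K₂) := by
  rw [quotHull_eq_diffImage h₁]
  exact ⟨diffQuotient (hydroEquiv K₁ h₁) (hydroEquiv K₂ h₂) h12,
    (isHydrodynamicMap_hydroEquiv h₁).diffQuotient (isHydrodynamicMap_hydroEquiv h₂) hb₁ h12⟩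

/-- **`g_{quotHull} ∘ g_{K₁} = g_{K₂}` on `ℍ ∖ K₂`.** [cite: Lawler2005, §3.4 (3.8)] -/
theorem hydroFun_quotHull_comp_eqOn (h₁ : HasHydroMap K₁) (h₂ : HasHydroMap K₂)
    (hb₁ : IsBounded (K₁ ∩ upperHalfPlaneSet)) (hb₂ : IsBounded (K₂ ∩ upperHalfPlaneSet))
    (h12 : upperHalfPlaneSet \ K₂ ⊆ upperHalfPlaneSet \ K₁) :
    EqOn (fun z ↦ hydroFun (quotHull K₁ K₂) (hydroFun K₁ z)) (hydroFun K₂) (upperHalfPlaneSet \ K₂) := by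
  intro z hz
  have hφ₁ := isHydrodynamicMap_hydroEquiv h₁
  have hφ₂ := isHydrodynamicMap_hydroEquiv h₂
  have hQ := hφ₁.diffQuotient hφ₂ hb₁ h12
  have hbQ := hφ₁.isBounded_diffImage hb₁ hb₂ (K₂ := K₂)
  have hw : hydroFun K₁ z ∈ upperHalfPlaneSet \ diffImage (hydroEquiv K₁ h₁) K₂ := by
    rw [← quotHull_eq_diffImage h₁]; exact mapsTo_hydroFun_diff_quotHull h₁ h12 hz
  simp only
  rw [quotHull_eq_diffImage h₁, hydroFun_eqOn hQ hbQ hw, diffQuotient_apply, hydroFun_apply h₁ (h12 hz),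
    (hydroEquiv K₁ h₁).symm_apply_apply (h12 hz), hydroFun_apply h₂ hz]

/-- **Additivity of the capacity: `hcapOf (quotHull K₁ K₂) = hcapOf K₂ - hcapOf K₁`.**
[cite: Lawler2005, §3.4 (3.8)] -/
theorem hcapOf_quotHull (h₁ : HasHydroMap K₁) (h₂ : HasHydroMap K₂)
    (hb₁ : IsBounded (K₁ ∩ upperHalfPlaneSet)) (hb₂ : IsBounded (K₂ ∩ upperHalfPlaneSet))
    (h12 : upperHalfPlaneSet \ K₂ ⊆ upperHalfPlaneSet \ K₁) :
    hcapOf (quotHull K₁ K₂) = hcapOf K₂ - hcapOf K₁ := by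
  have hφ₁ := isHydrodynamicMap_hydroEquiv h₁
  have hφ₂ := isHydrodynamicMap_hydroEquiv h₂
  have hQ := hφ₁.diffQuotient hφ₂ hb₁ h12
  have hbQ := hφ₁.isBounded_diffImage hb₁ hb₂ (K₂ := K₂)
  rw [quotHull_eq_diffImage h₁, hcapOf_eq hQ hbQ, hφ₁.hcap_diffQuotient hφ₂ hb₁ hb₂ h12,
    hcapOf_of_hasHydroMap h₁, hcapOf_of_hasHydroMap h₂]

/-- The capacity of the quotient hull is nonnegative (monotonicity `hcapOf_mono`). [folklore] -/
theorem hcapOf_quotHull_nonneg (h₁ : HasHydroMap K₁) (hb₁ : IsBounded (K₁ ∩ upperHalfPlaneSet))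
    (hb₂ : IsBounded (K₂ ∩ upperHalfPlaneSet)) : 0 ≤ hcapOf (quotHull K₁ K₂) :=
  hcapOf_nonneg (isBounded_quotHull h₁ hb₁ hb₂)

/-- **Transitivity of quotients** on the level of maps: for `K₁ ⊆ K₂ ⊆ K₃`,
`g_{quotHull K₂ K₃} ∘ g_{quotHull K₁ K₂} ∘ g_{K₁} = g_{K₃}` on `ℍ ∖ K₃`. [folklore] -/
theorem hydroFun_quotHull_comp_comp_eqOn {K₃ : Set ℂ} (h₁ : HasHydroMap K₁) (h₂ : HasHydroMap K₂)
    (h₃ : HasHydroMap K₃) (hb₁ : IsBounded (K₁ ∩ upperHalfPlaneSet))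
    (hb₂ : IsBounded (K₂ ∩ upperHalfPlaneSet)) (hb₃ : IsBounded (K₃ ∩ upperHalfPlaneSet))
    (h12 : upperHalfPlaneSet \ K₂ ⊆ upperHalfPlaneSet \ K₁)
    (h23 : upperHalfPlaneSet \ K₃ ⊆ upperHalfPlaneSet \ K₂) :
    EqOn (fun z ↦ hydroFun (quotHull K₂ K₃) (hydroFun (quotHull K₁ K₂) (hydroFun K₁ z))) (hydroFun K₃)
      (upperHalfPlaneSet \ K₃) := by
  intro z hz
  have e1 := hydroFun_quotHull_comp_eqOn h₁ h₂ hb₁ hb₂ h12 (h23 hz)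
  simp only at e1 ⊢
  rw [e1]
  exact hydroFun_quotHull_comp_eqOn h₂ h₃ hb₂ hb₃ h23 hz

namespace LatticeSlit

variable {D : DobrushinDomain} {φ : ConformalEquiv upperHalfPlaneSet D.carrier} {δ : ℝ}
  {a w₁ w₂ : Site 2}

/-- **The capacity clock of nested lattice pasts is the capacity of the quotient hull**:
`2 (t_{η₂} - t_{η₁}) = hcapOf (quotHull K_{η₁} K_{η₂})` for two walks whose hulls are bounded hulls
with `K_{η₁} ⊆ K_{η₂}` (e.g. a walk and its one-step extension inside `D`).
[cite: Lawler2005, §4.1 Remark 4.5 with §3.4 (3.8)] -/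
theorem two_mul_capTime_sub_capTime_eq (η₁ : (discreteDomainGraph D.carrier δ).Walk a w₁)
    (η₂ : (discreteDomainGraph D.carrier δ).Walk a w₂) (h₁ : IsBoundedHull (pastHull φ η₁))
    (h₂ : IsBoundedHull (pastHull φ η₂)) (hsub : pastHull φ η₁ ⊆ pastHull φ η₂) :
    2 * (capTime φ η₂ - capTime φ η₁) = hcapOf (quotHull (pastHull φ η₁) (pastHull φ η₂)) := by
  rw [mul_sub, two_mul_capTime, two_mul_capTime,
    hcapOf_quotHull h₁.hasHydroMap h₂.hasHydroMap (h₁.1.subset inter_subset_left)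
      (h₂.1.subset inter_subset_left) (sdiff_subset_sdiff_right hsub)]

/-- So the capacity time is monotone along nested pasts with bounded hulls. [folklore] -/
theorem capTime_le_capTime_of_subset (η₁ : (discreteDomainGraph D.carrier δ).Walk a w₁)
    (η₂ : (discreteDomainGraph D.carrier δ).Walk a w₂) (h₁ : IsBoundedHull (pastHull φ η₁))
    (h₂ : IsBoundedHull (pastHull φ η₂)) (hsub : pastHull φ η₁ ⊆ pastHull φ η₂) :
    capTime φ η₁ ≤ capTime φ η₂ := by
  have h := two_mul_capTime_sub_capTime_eq (φ := φ) η₁ η₂ h₁ h₂ hsub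
  have hnn := hcapOf_quotHull_nonneg (K₂ := pastHull φ η₂) h₁.hasHydroMap
    (h₁.1.subset inter_subset_left) (h₂.1.subset inter_subset_left)
  linarith

/-- **`g_{quotHull} ∘ g_{K_{η₁}} = g_{K_{η₂}}` off `K_{η₂}`** for nested lattice pasts with bounded
hulls. [cite: Lawler2005, §3.4 (3.8)] -/
theorem hydroFun_quotHull_pastHull_comp_eqOn (η₁ : (discreteDomainGraph D.carrier δ).Walk a w₁)
    (η₂ : (discreteDomainGraph D.carrier δ).Walk a w₂) (h₁ : IsBoundedHull (pastHull φ η₁))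
    (h₂ : IsBoundedHull (pastHull φ η₂)) (hsub : pastHull φ η₁ ⊆ pastHull φ η₂) :
    EqOn (fun z ↦ hydroFun (quotHull (pastHull φ η₁) (pastHull φ η₂)) (hydroFun (pastHull φ η₁) z))
      (hydroFun (pastHull φ η₂)) (upperHalfPlaneSet \ pastHull φ η₂) :=
  hydroFun_quotHull_comp_eqOn h₁.hasHydroMap h₂.hasHydroMap (h₁.1.subset inter_subset_left)
    (h₂.1.subset inter_subset_left) (sdiff_subset_sdiff_right hsub)

end LatticeSlit

end Literature.Probability.RandomPlanarGeometry

end
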